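import Literature.MathematicalPhysics.QuantumLattice.XYOrderIntegralProofs
import Literature.Probability.LatticeModels.LatticeGreenRiemannSum
import HarnessLib

/-!
# Kennedy–Lieb–Shastry, XY model: the Riemann sums converge to the lattice integral (fact (R))

Trunk T-QLATTICE; sibling proof file of `XYOrderProofs.lean` (item
`provefact-Literature.MathematicalPhysics.QuantumLa-23472b3373`). No statement or definition is
introduced or changed; this file discharges

* `klsRiemannSum_tendsto_holds : klsRiemannSum_tendsto` — fact **(R)** of `XYOrderProofs.lean`:
  for every `ν ≥ 2` the punctured Riemann sums `R_L = L^{-ν} Σ_{k ∈ (ℤ/Lℤ)^ν, k ≠ 0} F_ν(2πk/L)`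
  of the KLS integrand `F_ν(p) = [Σᵢ(1 + cos pᵢ)/Σᵢ(1 - cos pᵢ)]^{1/2} {ν⁻¹ Σᵢ cos pᵢ}₊`
  (Kennedy–Lieb–Shastry 1988, eq. (8)) converge, as `L → ∞` through **all** naturals, to
  `I(ν) = (2π)^{-ν} ∫_{[-π,π]^ν} F_ν` ("taking the usual infinite-volume limit and passing from sums
  to integrals", Kennedy–Lieb–Shastry, PRL 61 (1988) 2582, before eq. (2); Dyson–Lieb–Simon,
  J. Stat. Phys. 18 (1978) 335, §3).

## Proof ("standard approximation arguments", by dominated convergence)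

Write `δ = 2π/L` and index the `L^ν` grid cells `c_j + [0, δ)^ν` of `[-π,π)^ν` by `j ∈ (ℤ/Lℤ)^ν`
(`gridCell`, `cellCorner` of `LatticeGreenRiemannSum.lean`). The **tag** `t_j = δ m_j`,
`m_j = j - ⌊L/2⌋ ∈ ℤ^ν` (`cellOffset j`; in Lean the tag is written out as
`fun i => gridStep L * cellOffset j i`), lies in the closed lower half of its cell
(`0 ≤ t_j - c_j = π - δ⌊L/2⌋ ≤ δ/2`; it is the corner for even `L`), `t_{j₀} = 0` for the central
index `j₀ = (⌊L/2⌋, …)` (`centerIndex`), and `t_{k + j₀} ≡ 2πk/L (mod 2π)` coordinatewise, for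
every `L` (no parity condition). Since `F_ν` depends on `p` only through the `cos pᵢ`,
`Σ_{k ≠ 0} F_ν(2πk/L) = Σ_{j ≠ j₀} F_ν(t_j)`, so `(2π)^ν R_L = ∫ S_L` for the step function
`S_L = Σ_{j ≠ j₀} F_ν(t_j) 1_{cell_j}` (written out as a `Finset.sum` of `Set.indicator`s). Now
1. `S_L → F_ν` pointwise on `[-π,π)^ν ∖ {0}` (the tag of the cell containing `p` is within `δ` of
   `p`, eventually that cell is not the central one, and `F_ν` is continuous where `E(p) ≠ 0`);
2. `0 ≤ S_L ≤ 1_{[-π,π]^ν} · 2π√ν ‖p‖_∞⁻¹`: on the Brillouin zone `F_ν ≤ π√ν/‖p‖_∞`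
   (`Σ(1 + cos) ≤ 2ν`, `{·}₊ ≤ 1`, `E(p) ≥ (2/π²)‖p‖²_∞`, `mul_norm_sq_le_dispersion`), and on a
   non-central cell `‖p‖ ≤ ‖t_j‖ + δ ≤ 2‖t_j‖` (`‖t_j‖ = δ‖m_j‖ ≥ δ`);
3. `‖p‖⁻¹` is locally integrable in dimension `ν ≥ 2` (Mathlib
   `locallyIntegrable_of_norm_le_rpow`),
and Lebesgue's dominated convergence theorem gives `∫ S_L → ∫_{[-π,π)^ν} F_ν = ∫_{[-π,π]^ν} F_ν`.

## References

* T. Kennedy, E. H. Lieb, B. S. Shastry, *The XY model has long-range order for all spins and all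
  dimensions greater than one*, Phys. Rev. Lett. 61 (1988) 2582–2584 (`KLS1988PRL`), before
  eq. (2) and eq. (8).
* F. J. Dyson, E. H. Lieb, B. Simon, *Phase transitions in quantum spin systems with isotropic and
  nonisotropic interactions*, J. Stat. Phys. 18 (1978) 335–383 (`DysonLiebSimon1978`), §3.

## Design notes

No auxiliary definition is introduced: the tag `t_j` and the step function `S_L` are written out
in every statement (the names `klsTag`, `klsStep` occur only in lemma names and docstrings). The
grid-cell infrastructure (`gridStep`, `cellCorner`, `centerIndex`, `gridCell`, `cellOffset`, the
tiling `iUnion_gridCell` / `pairwise_disjoint_gridCell`, `brillouin`, `halfOpenBrillouin`) is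
imported from `Literature/Probability/LatticeModels/LatticeGreenRiemannSum.lean`, where the
analogous statement for the `‖p‖⁻²`-singular Green integrand in `d ≥ 3` is proved along even `L`
by an `ε/3` argument.
-/

noncomputable section

open MeasureTheory Filter Topology
open scoped Real
open Literature.MathematicalPhysics.QuantumLattice Literature.Probability.LatticeModels

namespace Literature.MathematicalPhysics.QuantumLattice

variable {ν : ℕ}

/-! ### Periodicity and the reindexing of the punctured grid sum -/

/-- `F_ν` is `2π`-periodic in every coordinate (it depends on `p` only through the `cos pᵢ`).
[folklore] -/
theorem klsIntegrand_add_two_pi_mul_int (p : Fin ν → ℝ) (q : Fin ν → ℤ) :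
    klsIntegrand ν (fun i => p i + 2 * π * (q i : ℝ)) = klsIntegrand ν p :=
  klsIntegrand_congr_cos fun i => by
    rw [show p i + 2 * π * (q i : ℝ) = p i + (q i : ℝ) * (2 * π) by ring,
      Real.cos_add_int_mul_two_pi]

/-- Shifting the momentum index by the central index `j₀ = (⌊L/2⌋, …, ⌊L/2⌋)` turns dual-torus
momenta into tags, up to periods: `t_{k + j₀} = δ m_{k + j₀} = 2πk/L + 2πq`, `q ∈ ℤ^ν` (every
`L ≥ 1`, no parity condition). [folklore] -/
theorem klsTag_add_centerIndex {L : ℕ} [NeZero L] (k : TorusSite ν L) :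
    ∃ q : Fin ν → ℤ, (fun i => gridStep L * (cellOffset (k + centerIndex ν L) i : ℝ)) =
      fun i => latticeMomentum L k i + 2 * π * (q i : ℝ) := by
  refine ⟨fun i => -((((k i).val + L / 2) / L : ℕ) : ℤ), funext fun i => ?_⟩
  have hLpos : 0 < L := Nat.pos_of_ne_zero (NeZero.ne L)
  have hL : (L : ℝ) ≠ 0 := by exact_mod_cast NeZero.ne L
  have hval : ((k + centerIndex ν L) i).val = ((k i).val + L / 2) % L := by
    simp only [Pi.add_apply, centerIndex]
    rw [ZMod.val_add, ZMod.val_natCast, Nat.mod_eq_of_lt (Nat.div_lt_self hLpos one_lt_two)]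
  have hmod : ((((k i).val + L / 2) % L : ℕ) : ℝ) =
      ((k i).val : ℝ) + ((L / 2 : ℕ) : ℝ) - (L : ℝ) * ((((k i).val + L / 2) / L : ℕ) : ℝ) := by
    have h := Nat.mod_add_div ((k i).val + L / 2) L
    have h' : ((((k i).val + L / 2) % L : ℕ) : ℝ) +
        (L : ℝ) * ((((k i).val + L / 2) / L : ℕ) : ℝ) = ((k i).val : ℝ) + ((L / 2 : ℕ) : ℝ) := by
      exact_mod_cast h
    linarith
  simp only [cellOffset, Int.cast_sub, Int.cast_natCast]
  rw [hval, hmod]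
  simp only [Int.cast_neg, Int.cast_natCast]
  unfold latticeMomentum gridStep
  field_simp
  ring

/-- **Reindexing the punctured grid sum**: the sum of `F_ν` over the nonzero dual-torus momenta is
the sum of `F_ν` over the tags `t_j = δ m_j` of all non-central cells (periodicity of `F_ν`).
[folklore] -/
theorem sum_klsIntegrand_latticeMomentum_eq (L : ℕ) [NeZero L] :
    ∑ k ∈ (Finset.univ : Finset (TorusSite ν L)).erase 0, klsIntegrand ν (latticeMomentum L k) =
      ∑ j ∈ (Finset.univ : Finset (TorusSite ν L)).erase (centerIndex ν L),
        klsIntegrand ν (fun i => gridStep L * (cellOffset j i : ℝ)) := by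
  have hterm : ∀ k : TorusSite ν L, klsIntegrand ν (latticeMomentum L k) =
      klsIntegrand ν (fun i => gridStep L * (cellOffset (k + centerIndex ν L) i : ℝ)) :=
    fun k => by
      obtain ⟨q, hq⟩ := klsTag_add_centerIndex k
      rw [hq, klsIntegrand_add_two_pi_mul_int]
  rw [Finset.sum_erase_eq_sub (Finset.mem_univ _), Finset.sum_erase_eq_sub (Finset.mem_univ _)]
  simp_rw [hterm]
  rw [zero_add]
  congr 1
  exact Equiv.sum_comp (Equiv.addRight (centerIndex ν L))
    fun j => klsIntegrand ν (fun i => gridStep L * (cellOffset j i : ℝ))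

/-! ### Geometry of the tags `t_j = δ m_j` -/

/-- `‖t_j‖_∞ = δ ‖m_j‖_∞`. [folklore] -/
theorem norm_klsTag {L : ℕ} [NeZero L] (j : TorusSite ν L) :
    ‖(fun i => gridStep L * (cellOffset j i : ℝ))‖ = gridStep L * ‖cellOffset j‖ := by
  have h : (fun i => gridStep L * (cellOffset j i : ℝ)) =
      gridStep L • fun i => (cellOffset j i : ℝ) := by
    funext i; simp
  rw [h, norm_smul, Real.norm_of_nonneg (gridStep_pos L).le]
  simp only [Pi.norm_def]
  rfl

/-- The offset of the central cell vanishes, `m_{j₀} = 0`. [folklore] -/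
theorem cellOffset_centerIndex (L : ℕ) [NeZero L] : cellOffset (centerIndex ν L) = 0 :=
  (cellOffset_eq_zero_iff (centerIndex ν L)).2 rfl

/-- The tag of the central cell is the origin, `t_{j₀} = 0`. [folklore] -/
theorem klsTag_centerIndex (L : ℕ) [NeZero L] :
    (fun i => gridStep L * (cellOffset (centerIndex ν L) i : ℝ)) = 0 := by
  funext i
  simp [cellOffset_centerIndex]

/-- The tag sits in the lower half of its cell: `0 ≤ t_j i - c_j i ≤ δ/2`
(`t_j i - c_j i = π - δ⌊L/2⌋`). [folklore] -/
theorem klsTag_sub_cellCorner {L : ℕ} [NeZero L] (j : TorusSite ν L) (i : Fin ν) :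
    0 ≤ gridStep L * (cellOffset j i : ℝ) - cellCorner j i ∧
      gridStep L * (cellOffset j i : ℝ) - cellCorner j i ≤ gridStep L / 2 := by
  have hδ := gridStep_pos L
  have hδL := gridStep_mul L
  have hnat : 2 * (L / 2) ≤ L ∧ L ≤ 2 * (L / 2) + 1 := by omega
  have h1 : (2 : ℝ) * ((L / 2 : ℕ) : ℝ) ≤ L := by exact_mod_cast hnat.1
  have h2 : (L : ℝ) ≤ 2 * ((L / 2 : ℕ) : ℝ) + 1 := by exact_mod_cast hnat.2
  have h1' : gridStep L * (2 * ((L / 2 : ℕ) : ℝ)) ≤ gridStep L * L :=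
    mul_le_mul_of_nonneg_left h1 hδ.le
  have h2' : gridStep L * (L : ℝ) ≤ gridStep L * (2 * ((L / 2 : ℕ) : ℝ) + 1) :=
    mul_le_mul_of_nonneg_left h2 hδ.le
  simp only [cellOffset, cellCorner, Int.cast_sub, Int.cast_natCast]
  constructor
  · nlinarith
  · nlinarith

/-- A tag belongs to its (half-open) cell. [folklore] -/
theorem klsTag_mem_gridCell {L : ℕ} [NeZero L] (j : TorusSite ν L) :
    (fun i => gridStep L * (cellOffset j i : ℝ)) ∈ gridCell j :=
  fun i _ => by
    obtain ⟨h1, h2⟩ := klsTag_sub_cellCorner j i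
    have hδ := gridStep_pos L
    exact ⟨by linarith, by linarith⟩

/-- Points of a cell are within `δ` of its tag in the sup norm. [folklore] -/
theorem norm_sub_klsTag_le {L : ℕ} [NeZero L] {j : TorusSite ν L} {p : Fin ν → ℝ}
    (hp : p ∈ gridCell j) : ‖p - fun i => gridStep L * (cellOffset j i : ℝ)‖ ≤ gridStep L := by
  refine (pi_norm_le_iff_of_nonneg (gridStep_pos L).le).2 fun i => ?_
  rw [Pi.sub_apply, Real.norm_eq_abs, abs_le]
  have h := hp i (Set.mem_univ i)
  obtain ⟨h1, h2⟩ := klsTag_sub_cellCorner j i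
  constructor <;> linarith [h.1, h.2]

/-- The origin lies in the central cell. [folklore] -/
theorem zero_mem_gridCell_centerIndex (L : ℕ) [NeZero L] :
    (0 : Fin ν → ℝ) ∈ gridCell (centerIndex ν L) := by
  have h := klsTag_mem_gridCell (centerIndex ν L)
  rwa [klsTag_centerIndex] at h

/-- A non-central tag is at sup-norm distance at least `δ` from the origin (`m_j ∈ ℤ^ν ∖ {0}`).
[folklore] -/
theorem gridStep_le_norm_klsTag {L : ℕ} [NeZero L] {j : TorusSite ν L}
    (hj : j ≠ centerIndex ν L) : gridStep L ≤ ‖(fun i => gridStep L * (cellOffset j i : ℝ))‖ := by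
  have hm0 : cellOffset j ≠ 0 := fun h => hj ((cellOffset_eq_zero_iff j).1 h)
  have hm1 : (1 : ℝ) ≤ ‖cellOffset j‖ := by
    obtain ⟨i, hi⟩ : ∃ i, cellOffset j i ≠ 0 := Function.ne_iff.1 hm0
    calc (1 : ℝ) ≤ ‖cellOffset j i‖ := by
          rw [Int.norm_eq_abs, ← Int.cast_abs]
          exact_mod_cast Int.one_le_abs hi
      _ ≤ ‖cellOffset j‖ := norm_le_pi_norm _ i
  have hδ := gridStep_pos L
  rw [norm_klsTag]
  nlinarith

/-- On a non-central cell, `‖p‖ ≤ ‖t_j‖ + δ ≤ 2‖t_j‖`. [folklore] -/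
theorem norm_le_two_mul_norm_klsTag {L : ℕ} [NeZero L] {j : TorusSite ν L}
    (hj : j ≠ centerIndex ν L) {p : Fin ν → ℝ} (hp : p ∈ gridCell j) :
    ‖p‖ ≤ 2 * ‖(fun i => gridStep L * (cellOffset j i : ℝ))‖ := by
  have ht := gridStep_le_norm_klsTag hj
  set t : Fin ν → ℝ := fun i => gridStep L * (cellOffset j i : ℝ) with ht_def
  calc ‖p‖ = ‖(p - t) + t‖ := by rw [sub_add_cancel]
    _ ≤ ‖p - t‖ + ‖t‖ := norm_add_le _ _
    _ ≤ gridStep L + ‖t‖ := by gcongr; exact norm_sub_klsTag_le hp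
    _ ≤ 2 * ‖t‖ := by linarith

/-! ### The integrand: size near the singularity, continuity, the dominating function -/

/-- **Size of the KLS integrand near its singularity**: on the Brillouin zone,
`F_ν(p) ≤ π√ν / ‖p‖_∞` for `p ≠ 0` (`Σᵢ(1 + cos pᵢ) ≤ 2ν`, `{·}₊ ≤ 1`, and Jordan's inequality
`E(p) ≥ (2/π²)‖p‖²_∞`); in particular `F_ν = O(|p|⁻¹)` is integrable in dimension `≥ 2`.
[folklore] -/
theorem klsIntegrand_le_div_norm {p : Fin ν → ℝ} (hp : p ∈ brillouin ν) (hp0 : p ≠ 0) :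
    klsIntegrand ν p ≤ π * Real.sqrt ν / ‖p‖ := by
  have hE := mul_norm_sq_le_dispersion hp
  have hpos : 0 < ‖p‖ := norm_pos_iff.2 hp0
  have hnum : (∑ i, (1 + Real.cos (p i))) ≤ 2 * ν := by
    calc (∑ i, (1 + Real.cos (p i))) ≤ ∑ _i : Fin ν, (2 : ℝ) :=
          Finset.sum_le_sum fun i _ => by linarith [Real.cos_le_one (p i)]
      _ = 2 * ν := by simp [mul_comm]
  have hmax : max ((∑ i, Real.cos (p i)) / (ν : ℝ)) 0 ≤ 1 := by
    refine max_le ?_ zero_le_one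
    rcases Nat.eq_zero_or_pos ν with hν | hν
    · subst hν; simp
    · rw [div_le_one (by exact_mod_cast hν)]
      calc (∑ i, Real.cos (p i)) ≤ ∑ _i : Fin ν, (1 : ℝ) :=
            Finset.sum_le_sum fun i _ => Real.cos_le_one _
        _ = ν := by simp
  have hden : (∑ i, (1 - Real.cos (p i))) = dispersion p := rfl
  have hkey : (∑ i, (1 + Real.cos (p i))) / dispersion p ≤ (2 * ν) / (2 / π ^ 2 * ‖p‖ ^ 2) :=
    div_le_div₀ (by positivity) hnum (mul_pos (by positivity) (pow_pos hpos 2)) hE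
  have hsq : (2 * (ν : ℝ)) / (2 / π ^ 2 * ‖p‖ ^ 2) = (π * Real.sqrt ν / ‖p‖) ^ 2 := by
    rw [div_pow, mul_pow, Real.sq_sqrt (Nat.cast_nonneg ν)]
    field_simp
  unfold klsIntegrand
  rw [hden]
  calc Real.sqrt ((∑ i, (1 + Real.cos (p i))) / dispersion p) *
        max ((∑ i, Real.cos (p i)) / (ν : ℝ)) 0
      ≤ Real.sqrt ((2 * ν) / (2 / π ^ 2 * ‖p‖ ^ 2)) * 1 :=
        mul_le_mul (Real.sqrt_le_sqrt hkey) hmax (le_max_right _ _) (Real.sqrt_nonneg _)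
    _ = π * Real.sqrt ν / ‖p‖ := by
        rw [mul_one, hsq, Real.sqrt_sq (by positivity)]

/-- `F_ν` is continuous at every `p` with `E(p) ≠ 0`. [folklore] -/
theorem continuousAt_klsIntegrand {p : Fin ν → ℝ} (hp : dispersion p ≠ 0) :
    ContinuousAt (klsIntegrand ν) p := by
  have hnum : Continuous fun q : Fin ν → ℝ => ∑ i, (1 + Real.cos (q i)) := by fun_prop
  have hcos : Continuous fun q : Fin ν → ℝ => ∑ i, Real.cos (q i) := by fun_prop
  have h1 : ContinuousAt (fun q : Fin ν → ℝ => (∑ i, (1 + Real.cos (q i))) / dispersion q) p :=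
    hnum.continuousAt.div (continuous_dispersion ν).continuousAt hp
  have h2 : ContinuousAt (fun q : Fin ν → ℝ =>
      Real.sqrt ((∑ i, (1 + Real.cos (q i))) / dispersion q) *
        max ((∑ i, Real.cos (q i)) / (ν : ℝ)) 0) p :=
    h1.sqrt.mul ((hcos.div_const _).max continuous_const).continuousAt
  exact h2

variable (ν) in
/-- The dominating function `1_{[-π,π]^ν}(p) · 2π√ν ‖p‖_∞⁻¹` is integrable for `ν ≥ 2`
(`‖p‖⁻¹` is locally integrable in dimension `≥ 2`, Mathlib `locallyIntegrable_of_norm_le_rpow`).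
[folklore] -/
theorem integrable_klsBound (hν : 2 ≤ ν) :
    Integrable ((brillouin ν).indicator
      fun p : Fin ν → ℝ => 2 * (π * Real.sqrt ν) * ‖p‖ ^ (-(1 : ℝ))) volume := by
  set g : (Fin ν → ℝ) → ℝ := fun p => 2 * (π * Real.sqrt ν) * ‖p‖ ^ (-(1 : ℝ)) with hg
  set f := (brillouin ν).indicator g with hf
  have hgm : Measurable g := measurable_const.mul (measurable_norm.pow_const _)
  have hmeas : AEStronglyMeasurable f volume :=
    (hgm.indicator (measurableSet_brillouin ν)).aestronglyMeasurable
  have hg0 : ∀ p, 0 ≤ g p := fun p => by positivity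
  have hdecay : ∀ p, ‖f p‖ ≤ 2 * (π * Real.sqrt ν) * ‖p‖ ^ (-(1 : ℝ)) := by
    intro p
    rw [Real.norm_eq_abs, abs_of_nonneg (Set.indicator_nonneg (fun q _ => hg0 q) p)]
    exact Set.indicator_le_self' (fun q _ => hg0 q) p
  have hrank : Module.finrank ℝ (Fin ν → ℝ) = ν := Module.finrank_fin_fun ℝ
  have hloc : LocallyIntegrable f volume :=
    locallyIntegrable_of_norm_le_rpow (by rw [hrank]; omega)
      (by rw [hrank]; exact_mod_cast (by omega : 1 < ν)) (Eventually.of_forall hdecay) hmeas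
  have hK : IntegrableOn f (brillouin ν) volume :=
    hloc.integrableOn_isCompact (isCompact_brillouin ν)
  have hK' : IntegrableOn g (brillouin ν) volume :=
    (integrableOn_congr_fun (Set.eqOn_indicator (s := brillouin ν) (f := g))
      (measurableSet_brillouin ν)).1 hK
  exact (integrable_indicator_iff (measurableSet_brillouin ν)).2 hK'

/-! ### Step functions on the grid cells -/

/-- A step function `Σ_{j ∈ s} c_j 1_{cell_j}` on the grid cells is measurable. [folklore] -/
theorem measurable_sum_indicator_gridCell {L : ℕ} (s : Finset (TorusSite ν L))
    (c : TorusSite ν L → ℝ) :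
    Measurable fun p : Fin ν → ℝ => ∑ j ∈ s, (gridCell j).indicator (fun _ => c j) p :=
  Finset.measurable_sum _ fun j _ => measurable_const.indicator (measurableSet_gridCell j)

/-- `∫ Σ_{j ∈ s} c_j 1_{cell_j} = δ^ν Σ_{j ∈ s} c_j` (each cell has volume `δ^ν`). [folklore] -/
theorem integral_sum_indicator_gridCell {L : ℕ} [NeZero L] (s : Finset (TorusSite ν L))
    (c : TorusSite ν L → ℝ) :
    ∫ p, ∑ j ∈ s, (gridCell j).indicator (fun _ => c j) p = gridStep L ^ ν * ∑ j ∈ s, c j := by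
  rw [integral_finsetSum _ (fun j _ =>
    (integrableOn_const (volume_gridCell_lt_top j).ne).integrable_indicator
      (measurableSet_gridCell j))]
  rw [Finset.mul_sum]
  refine Finset.sum_congr rfl fun j _ => ?_
  rw [integral_indicator_const _ (measurableSet_gridCell j), smul_eq_mul, measureReal_def,
    volume_gridCell_toReal]

/-- On the cell `j ∈ s`, `Σ_{j' ∈ s} c_{j'} 1_{cell_{j'}} = c_j` (the cells are disjoint).
[folklore] -/
theorem sum_indicator_gridCell_eq_of_mem {L : ℕ} [NeZero L] {s : Finset (TorusSite ν L)}
    (c : TorusSite ν L → ℝ) {j : TorusSite ν L} (hj : j ∈ s) {p : Fin ν → ℝ}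
    (hp : p ∈ gridCell j) : ∑ j' ∈ s, (gridCell j').indicator (fun _ => c j') p = c j := by
  rw [Finset.sum_eq_single_of_mem j hj]
  · exact Set.indicator_of_mem hp _
  · intro b _ hb
    refine Set.indicator_of_notMem (fun hpb => ?_) _
    exact Set.disjoint_left.1 (pairwise_disjoint_gridCell ν L hb) hpb hp

/-- On a cell `j ∉ s`, `Σ_{j' ∈ s} c_{j'} 1_{cell_{j'}} = 0`. [folklore] -/
theorem sum_indicator_gridCell_eq_zero_of_mem {L : ℕ} [NeZero L] {s : Finset (TorusSite ν L)}
    (c : TorusSite ν L → ℝ) {j : TorusSite ν L} (hj : j ∉ s) {p : Fin ν → ℝ}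
    (hp : p ∈ gridCell j) : ∑ j' ∈ s, (gridCell j').indicator (fun _ => c j') p = 0 := by
  refine Finset.sum_eq_zero fun b hb => ?_
  refine Set.indicator_of_notMem (fun hpb => ?_) _
  have hbj : b ≠ j := fun h => hj (h ▸ hb)
  exact Set.disjoint_left.1 (pairwise_disjoint_gridCell ν L hbj) hpb hp

/-- Off `[-π,π)^ν`, `Σ_{j ∈ s} c_j 1_{cell_j} = 0`. [folklore] -/
theorem sum_indicator_gridCell_eq_zero_of_not_mem {L : ℕ} [NeZero L] (s : Finset (TorusSite ν L))
    (c : TorusSite ν L → ℝ) {p : Fin ν → ℝ} (hp : p ∉ halfOpenBrillouin ν) :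
    ∑ j ∈ s, (gridCell j).indicator (fun _ => c j) p = 0 := by
  refine Finset.sum_eq_zero fun b _ => ?_
  exact Set.indicator_of_notMem (fun hpb => hp (gridCell_subset_halfOpenBrillouin b hpb)) _

/-! ### The step function `S_L = Σ_{j ≠ j₀} F_ν(t_j) 1_{cell_j}` of the punctured Riemann sum -/

/-- **Domination**: `0 ≤ S_L(p) ≤ 1_{[-π,π]^ν}(p) · 2π√ν ‖p‖_∞⁻¹` for every `L ≥ 1`. [folklore] -/
theorem klsStep_le_bound (L : ℕ) [NeZero L] (p : Fin ν → ℝ) :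
    0 ≤ ∑ j ∈ (Finset.univ : Finset (TorusSite ν L)).erase (centerIndex ν L),
        (gridCell j).indicator
          (fun _ => klsIntegrand ν fun i => gridStep L * (cellOffset j i : ℝ)) p ∧
      ∑ j ∈ (Finset.univ : Finset (TorusSite ν L)).erase (centerIndex ν L),
        (gridCell j).indicator
          (fun _ => klsIntegrand ν fun i => gridStep L * (cellOffset j i : ℝ)) p ≤
      (brillouin ν).indicator
        (fun p : Fin ν → ℝ => 2 * (π * Real.sqrt ν) * ‖p‖ ^ (-(1 : ℝ))) p := by
  refine ⟨Finset.sum_nonneg fun _ _ =>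
    Set.indicator_nonneg (fun _ _ => klsIntegrand_nonneg _ _) _, ?_⟩
  set c : TorusSite ν L → ℝ :=
    fun j => klsIntegrand ν fun i => gridStep L * (cellOffset j i : ℝ) with hc
  have hB0 : ∀ q, 0 ≤ (brillouin ν).indicator
      (fun p : Fin ν → ℝ => 2 * (π * Real.sqrt ν) * ‖p‖ ^ (-(1 : ℝ))) q :=
    fun q => Set.indicator_nonneg (fun q _ => by positivity) q
  by_cases hp : p ∈ halfOpenBrillouin ν
  · obtain ⟨j, hpj⟩ : ∃ j : TorusSite ν L, p ∈ gridCell j := by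
      have h : p ∈ ⋃ j : TorusSite ν L, gridCell j := by rwa [iUnion_gridCell ν L]
      exact Set.mem_iUnion.1 h
    by_cases hj : j = centerIndex ν L
    · subst hj
      rw [sum_indicator_gridCell_eq_zero_of_mem c (Finset.notMem_erase _ _) hpj]
      exact hB0 p
    · rw [sum_indicator_gridCell_eq_of_mem c (Finset.mem_erase.2 ⟨hj, Finset.mem_univ _⟩) hpj]
      have hpB : p ∈ brillouin ν := halfOpenBrillouin_subset_brillouin ν hp
      have hp0 : p ≠ 0 := by
        rintro rfl
        refine hj ?_
        by_contra hne
        exact Set.disjoint_left.1 (pairwise_disjoint_gridCell ν L hne) hpj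
          (zero_mem_gridCell_centerIndex L)
      have hnp : 0 < ‖p‖ := norm_pos_iff.2 hp0
      set t : Fin ν → ℝ := fun i => gridStep L * (cellOffset j i : ℝ) with ht_def
      have htB : t ∈ brillouin ν := gridCell_subset_brillouin j (klsTag_mem_gridCell j)
      have ht0 : t ≠ 0 :=
        norm_pos_iff.1 (lt_of_lt_of_le (gridStep_pos L) (gridStep_le_norm_klsTag hj))
      rw [Set.indicator_of_mem hpB]
      calc c j = klsIntegrand ν t := rfl
        _ ≤ π * Real.sqrt ν / ‖t‖ := klsIntegrand_le_div_norm htB ht0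
        _ ≤ π * Real.sqrt ν / (‖p‖ / 2) :=
            div_le_div_of_nonneg_left (by positivity) (by positivity)
              (by linarith [norm_le_two_mul_norm_klsTag hj hpj])
        _ = 2 * (π * Real.sqrt ν) * ‖p‖ ^ (-(1 : ℝ)) := by
            rw [Real.rpow_neg (norm_nonneg _), Real.rpow_one, div_div_eq_mul_div]
            field_simp
  · rw [sum_indicator_gridCell_eq_zero_of_not_mem _ c hp]
    exact hB0 p

/-- **Pointwise convergence** off the origin: for `p ∈ [-π,π)^ν`, `p ≠ 0`, `S_L(p) → F_ν(p)` as
`L → ∞` (the tag of the cell of `p` is within `δ = 2π/L` of `p`, eventually that cell is not the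
central one, and `F_ν` is continuous at `p` since `E(p) > 0`). [folklore] -/
theorem tendsto_klsStep {p : Fin ν → ℝ} (hp : p ∈ halfOpenBrillouin ν) (hp0 : p ≠ 0) :
    Tendsto (fun L : ℕ =>
      ∑ j ∈ (Finset.univ : Finset (TorusSite ν (L + 1))).erase (centerIndex ν (L + 1)),
        (gridCell j).indicator
          (fun _ => klsIntegrand ν fun i => gridStep (L + 1) * (cellOffset j i : ℝ)) p)
      atTop (𝓝 (klsIntegrand ν p)) := by
  have hcell : ∀ L : ℕ, ∃ j : TorusSite ν (L + 1), p ∈ gridCell j := fun L => by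
    have h : p ∈ ⋃ j : TorusSite ν (L + 1), gridCell j := by rwa [iUnion_gridCell ν (L + 1)]
    exact Set.mem_iUnion.1 h
  choose j hj using hcell
  -- the grid step tends to zero, so the tags of the cells of `p` tend to `p`
  have hδ : Tendsto (fun L : ℕ => gridStep (L + 1)) atTop (𝓝 0) := by
    have h : Tendsto (fun L : ℕ => ((L + 1 : ℕ) : ℝ)) atTop atTop :=
      tendsto_natCast_atTop_atTop.comp (tendsto_add_atTop_nat 1)
    exact tendsto_const_nhds.div_atTop h
  have htag : Tendsto (fun L : ℕ => fun i => gridStep (L + 1) * (cellOffset (j L) i : ℝ))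
      atTop (𝓝 p) := by
    rw [tendsto_iff_norm_sub_tendsto_zero]
    refine squeeze_zero (fun L => norm_nonneg _) (fun L => ?_) hδ
    rw [norm_sub_rev]
    exact norm_sub_klsTag_le (hj L)
  have hcont : ContinuousAt (klsIntegrand ν) p :=
    continuousAt_klsIntegrand (dispersion_pos_of_mem_brillouin
      (halfOpenBrillouin_subset_brillouin ν hp) hp0).ne'
  have hlim : Tendsto (fun L : ℕ =>
      klsIntegrand ν fun i => gridStep (L + 1) * (cellOffset (j L) i : ℝ)) atTop
      (𝓝 (klsIntegrand ν p)) :=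
    hcont.tendsto.comp htag
  -- eventually the cell of `p` is not the central one
  refine hlim.congr' ?_
  filter_upwards [(tendsto_order.1 hδ).2 ‖p‖ (norm_pos_iff.2 hp0)] with L hL
  have hjc : j L ≠ centerIndex ν (L + 1) := fun hjc => by
    have h1 := norm_sub_klsTag_le (hj L)
    rw [hjc, klsTag_centerIndex, sub_zero] at h1
    exact absurd (h1.trans_lt hL) (lt_irrefl _)
  exact (sum_indicator_gridCell_eq_of_mem
    (fun j' => klsIntegrand ν fun i => gridStep (L + 1) * (cellOffset j' i : ℝ))
    (Finset.mem_erase.2 ⟨hjc, Finset.mem_univ _⟩) (hj L)).symm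

/-- `(2π)^{-ν} ∫ S_L = R_L`: the integral of the step function is the punctured Riemann sum
(`∫ S_L = δ^ν Σ_{j ≠ j₀} F_ν(t_j) = δ^ν Σ_{k ≠ 0} F_ν(2πk/L)` and `δ L = 2π`). [folklore] -/
theorem integral_klsStep_div (ν L : ℕ) [NeZero L] :
    (∫ p, ∑ j ∈ (Finset.univ : Finset (TorusSite ν L)).erase (centerIndex ν L),
        (gridCell j).indicator
          (fun _ => klsIntegrand ν fun i => gridStep L * (cellOffset j i : ℝ)) p) /
        (2 * π) ^ ν = klsRiemannSum ν L := by
  rw [integral_sum_indicator_gridCell, ← sum_klsIntegrand_latticeMomentum_eq,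
    klsRiemannSum_of_neZero]
  have hL : (L : ℝ) ≠ 0 := by exact_mod_cast NeZero.ne L
  have h2π : (2 * π : ℝ) ≠ 0 := by positivity
  unfold gridStep
  rw [div_pow]
  field_simp

/-! ### Fact (R) -/

/-- **Fact (R) of `XYOrderProofs.lean`, proved: "passing from sums to integrals"**
(Kennedy–Lieb–Shastry, PRL 61 (1988) 2582, before eq. (2): "taking the usual infinite-volume
limit and passing from sums to integrals"; Dyson–Lieb–Simon, J. Stat. Phys. 18 (1978) 335, §3).
For every `ν ≥ 2` the punctured Riemann sums `R_L = L^{-ν} Σ_{k ≠ 0} F_ν(2πk/L)` of the KLS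
integrand (eq. (8)) over the dual torus converge to `I(ν) = (2π)^{-ν} ∫_{[-π,π]^ν} F_ν` as `L → ∞`:
`(2π)^ν R_L` is the integral of the step function `S_L` (tags `t_j ≡ 2πk/L mod 2π` in the cells of
`[-π,π)^ν`, central cell omitted), `S_L → F_ν` off the origin, and `0 ≤ S_L ≤ 2π√ν 1_{[-π,π]^ν}
‖p‖_∞⁻¹ ∈ L¹` for `ν ≥ 2`, so dominated convergence applies.
[Kennedy–Lieb–Shastry 1988, before eq. (2)] [folklore] -/
theorem klsRiemannSum_tendsto_holds : klsRiemannSum_tendsto := by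
  intro ν hν
  haveI : Nonempty (Fin ν) := ⟨⟨0, by omega⟩⟩
  -- dominated convergence for the step functions `S_{L+1}`
  have hDCT : Tendsto (fun L : ℕ => ∫ p,
      ∑ j ∈ (Finset.univ : Finset (TorusSite ν (L + 1))).erase (centerIndex ν (L + 1)),
        (gridCell j).indicator
          (fun _ => klsIntegrand ν fun i => gridStep (L + 1) * (cellOffset j i : ℝ)) p) atTop
      (𝓝 (∫ p, (halfOpenBrillouin ν).indicator (klsIntegrand ν) p)) := by
    refine tendsto_integral_of_dominated_convergence
      ((brillouin ν).indicator fun p : Fin ν → ℝ => 2 * (π * Real.sqrt ν) * ‖p‖ ^ (-(1 : ℝ)))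
      (fun L => (measurable_sum_indicator_gridCell _ _).aestronglyMeasurable)
      (integrable_klsBound ν hν) (fun L => Eventually.of_forall fun p => ?_) ?_
    · obtain ⟨h0, h1⟩ := klsStep_le_bound (ν := ν) (L + 1) p
      rw [Real.norm_eq_abs, abs_of_nonneg h0]
      exact h1
    · filter_upwards [Measure.ae_ne volume (0 : Fin ν → ℝ)] with p hp0
      by_cases hp : p ∈ halfOpenBrillouin ν
      · rw [Set.indicator_of_mem hp]
        exact tendsto_klsStep hp hp0
      · rw [Set.indicator_of_notMem hp]
        have hzero : ∀ L : ℕ,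
            ∑ j ∈ (Finset.univ : Finset (TorusSite ν (L + 1))).erase (centerIndex ν (L + 1)),
              (gridCell j).indicator
                (fun _ => klsIntegrand ν fun i => gridStep (L + 1) * (cellOffset j i : ℝ)) p =
              0 :=
          fun L => sum_indicator_gridCell_eq_zero_of_not_mem _ _ hp
        simp only [hzero]
        exact tendsto_const_nhds
  -- the limit is the Brillouin integral
  have hlimit : ∫ p, (halfOpenBrillouin ν).indicator (klsIntegrand ν) p =
      ∫ p in brillouin ν, klsIntegrand ν p := by
    rw [integral_indicator (show MeasurableSet (halfOpenBrillouin ν) from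
      MeasurableSet.univ_pi fun _ => measurableSet_Ico)]
    exact setIntegral_congr_set (halfOpenBrillouin_ae_eq_brillouin ν)
  rw [hlimit] at hDCT
  -- divide by `(2π)^ν` and shift the index
  have h2 : Tendsto (fun L : ℕ => klsRiemannSum ν (L + 1)) atTop (𝓝 (klsIntegral ν)) := by
    have h := hDCT.div_const ((2 * π) ^ ν)
    simp only [integral_klsStep_div] at h
    exact h
  exact (tendsto_add_atTop_iff_nat 1).1 h2

end Literature.MathematicalPhysics.QuantumLattice
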